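import Mathlib.Algebra.MvPolynomial.CommRing
import Mathlib.Data.Fin.VecNotation
import Mathlib.Data.ZMod.Basic
import Mathlib.RingTheory.Ideal.Operations
import HarnessLib

/-!
# [OURS · L1 W4.5(b) · EL♮(3)] Specimen S_cr(G₇) — «THE ISLAND CREASE NOSE»: pointwise and chart facts
# (kill side, res-L1-w45b-lead-1 g19; memo `L/res-L1-w45b-lead-1/CREASE7-CERTIFICATE.md`; crux `EquisingularLiftNatThree`, stmt-ResolutionOfSingularities-20148)

NOT a statement of any manuscript; OURS kernel specimen.  AI-written, weaker than expert review.  Nothing of [Hironaka2017] is asserted; EL♮(3) is NOT proved here;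
this file does NOT prove that S_cr(G₇) lies outside any typed class (that is the memo's by-letters certificate: persistence, heredity of deep points, the scar lemma
✓ p569735).  It certifies the ring identities and the finitely many values the certificate and its panel replay rest on.
THE OBJECT (over `𝔽₇`): `g₇ = y⁷z − x⁸ − 3x²z⁶ − z⁸` (the island, cusps `q_r = (r : 4r²+1 : 1 : 0)`), `B = x¹² + 2y¹² + 3z¹² + w¹² + x⁵y⁷ + xyz¹⁰`, `F = g₇² + w⁴B`
(transversal type A₃ along `Z = V(w, g₇)`); variables `X 0 = x, X 1 = y, X 2 = z, X 3 = w`.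
* `F_mem_sq`           : `F ∈ (w, g₇)²` (S singular along Z; kit j327616: `Sing S = Z` exactly);
* `round_chart`        : the direct round, chart `g₇ = wU`: `(wU)² + w⁴B = w²·(U² + w²B)` — strict transform `U² + w²B`, singular along the CREASE `{U = w = 0}`;
* (the crease round's chart `U = wU₁`, `(wU₁)² + w²B = w²·(U₁² + B)`, IS ✓ p703064's `SpecimenSnuG7.chart_U` — cited, not restated); `crease_round_chart'` = its other chart;
* `B_cusp`, `B_cusp_ne_zero` : `B(q_r) = 5,2,3,1,4,2,3` (all `≠ 0`: no pinch at a cusp; over each cusp `U₁² = −B(q_r)` has two roots — the 14 deep A₆ points);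
* `negB_cusp_square_iff` : `−B(q_r)` is a square in `𝔽₇` exactly for `r ∈ {0, 2, 6}` (so 6 of the 14 points are `𝔽₇`-rational, 8 live over `𝔽₄₉` — kit (c)).
`--supports stmt-ResolutionOfSingularities-20148 --as helper`; def-free; standard axioms.
-/

set_option linter.dupNamespace false -- mandated namespace `Summit.<Summit>.<Problem>` of this single-conjunct summit

noncomputable section

open MvPolynomial

namespace Summit.ResolutionOfSingularities.ResolutionOfSingularities.Cruxes.EquisingularLiftNat.Sections

namespace SpecimenCreaseG7

section anyRing

variable (R : Type) [CommRing R]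

/-- [OURS · L1 W4.5b] `F = g₇² + w⁴B ∈ (w, g₇)²`. [folklore] -/
theorem F_mem_sq :
    ((X 1 ^ 7 * X 2 - X 0 ^ 8 - 3 * X 0 ^ 2 * X 2 ^ 6 - X 2 ^ 8) ^ 2 +
        X 3 ^ 4 * (X 0 ^ 12 + 2 * X 1 ^ 12 + 3 * X 2 ^ 12 + X 3 ^ 12 + X 0 ^ 5 * X 1 ^ 7 + X 0 * X 1 * X 2 ^ 10) : MvPolynomial (Fin 4) R) ∈
      (Ideal.span {(X 3 : MvPolynomial (Fin 4) R), X 1 ^ 7 * X 2 - X 0 ^ 8 - 3 * X 0 ^ 2 * X 2 ^ 6 - X 2 ^ 8}) ^ 2 := by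
  have hw : (X 3 : MvPolynomial (Fin 4) R) ∈
      Ideal.span {(X 3 : MvPolynomial (Fin 4) R), X 1 ^ 7 * X 2 - X 0 ^ 8 - 3 * X 0 ^ 2 * X 2 ^ 6 - X 2 ^ 8} :=
    Ideal.subset_span (Set.mem_insert _ _)
  have hg : (X 1 ^ 7 * X 2 - X 0 ^ 8 - 3 * X 0 ^ 2 * X 2 ^ 6 - X 2 ^ 8 : MvPolynomial (Fin 4) R) ∈
      Ideal.span {(X 3 : MvPolynomial (Fin 4) R), X 1 ^ 7 * X 2 - X 0 ^ 8 - 3 * X 0 ^ 2 * X 2 ^ 6 - X 2 ^ 8} :=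
    Ideal.subset_span (Set.mem_insert_of_mem _ (Set.mem_singleton _))
  exact Ideal.add_mem _ (Ideal.pow_mem_pow hg 2)
    (Ideal.mul_mem_right _ _ (Ideal.pow_le_pow_right (by norm_num) (Ideal.pow_mem_pow hw 4)))

/-- [OURS · L1 W4.5b] The direct round at `Z`, chart `g₇ = wU`: `(wU)² + w⁴B = w²(U² + w²B)`; the strict transform `U² + w²B` is singular along the crease `U = w = 0`. [folklore] -/
theorem round_chart (w U B : R) : (w * U) ^ 2 + w ^ 4 * B = w ^ 2 * (U ^ 2 + w ^ 2 * B) := by ring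

/-- [OURS · L1 W4.5b] The crease round's other chart `w = Uw₁` (the chart `U = wU₁` is `SpecimenSnuG7.chart_U`): `U² + (Uw₁)²B = U²(1 + w₁²B)` (no point of the strict transform at `w₁ = 0`). [folklore] -/
theorem crease_round_chart' (w₁ U B : R) : U ^ 2 + (U * w₁) ^ 2 * B = U ^ 2 * (1 + w₁ ^ 2 * B) := by ring

end anyRing

section charSeven

/-- [OURS · L1 W4.5b] `B(q_r) = 5, 2, 3, 1, 4, 2, 3` at the seven cusps `q_r = (r, 4r²+1, 1, 0)` (kit j327616 (a)). [folklore] -/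
theorem B_cusp (r : ZMod 7) :
    eval ![r, 4 * r ^ 2 + 1, 1, 0]
        (X 0 ^ 12 + 2 * X 1 ^ 12 + 3 * X 2 ^ 12 + X 3 ^ 12 + X 0 ^ 5 * X 1 ^ 7 + X 0 * X 1 * X 2 ^ 10 : MvPolynomial (Fin 4) (ZMod 7)) =
      (![5, 2, 3, 1, 4, 2, 3] : Fin 7 → ZMod 7) r := by
  simp only [map_add, map_mul, map_pow, eval_X, map_ofNat, Matrix.cons_val_zero, Matrix.cons_val_one, Matrix.cons_val_two,
    Matrix.cons_val_three, Matrix.tail_cons, Matrix.head_cons]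
  revert r; decide

/-- [OURS · L1 W4.5b] … all non-zero: no pinch point sits at a cusp, and over each cusp the crease round leaves exactly two points `U₁ = ±√(−B(q_r))`. [folklore] -/
theorem B_cusp_ne_zero (r : ZMod 7) :
    eval ![r, 4 * r ^ 2 + 1, 1, 0]
        (X 0 ^ 12 + 2 * X 1 ^ 12 + 3 * X 2 ^ 12 + X 3 ^ 12 + X 0 ^ 5 * X 1 ^ 7 + X 0 * X 1 * X 2 ^ 10 : MvPolynomial (Fin 4) (ZMod 7)) ≠ 0 := by
  rw [B_cusp]; revert r; decide

/-- [OURS · L1 W4.5b] `−B(q_r)` is a square in `𝔽₇` iff `r ∈ {0, 2, 6}`: six of the fourteen deep points are `𝔽₇`-rational, eight live over `𝔽₄₉` (kit (c)). [folklore] -/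
theorem negB_cusp_square_iff (r : ZMod 7) :
    (∃ s : ZMod 7, s ^ 2 = -((![5, 2, 3, 1, 4, 2, 3] : Fin 7 → ZMod 7) r)) ↔ (r = 0 ∨ r = 2 ∨ r = 6) := by
  revert r; decide

end charSeven

end SpecimenCreaseG7

end Summit.ResolutionOfSingularities.ResolutionOfSingularities.Cruxes.EquisingularLiftNat.Sections

end
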